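import Literature.Probability.LatticeModels.CurrentClusters
import HarnessLib

/-!
# Deterministic exploration of a current from a vertex (Aizenman's random-walk representation)

Topic `Literature/Probability/LatticeModels`, namespace `Literature.Probability.LatticeModels`
(dot-notation extensions in `….Current`). Infrastructure for the proof of Aizenman 1982,
Proposition 12.1 (`aizenman_wickDeviation_le_finite`, `AizenmanWickBound.lean`), which rests on the
**random-walk representation** of M. Aizenman, *Geometric analysis of `φ⁴` fields and Ising models*,
Comm. Math. Phys. **86** (1982), §9: "if `∂n = {x, y}` then any nonrepeating path along bonds with odd
values of `n` which starts at `x`, eventually reaches `y`. We construct a random walk by the following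
iterative procedure … (ii) at each step choose a bond … which were not traversed before. (iii) Check the
parity of `n` for the chosen bond. If `n_b` is odd, the random walk *traverses* the bond, moving to its
other end. If `n_b` is even, no move is made but the bond is recorded as *attempted*. (iv) The walk stops
upon the first hit of `y`" (p. 23), with the weights `ρ(ω) = q(ω) s(ω) z(B(ω))` of Prop. 9.2 and the
compatibility / super-multiplicativity of Lemma 9.3.

This file formalises a **deterministic** variant of the walk, which is all the proof of Prop. 12.1 uses:
the bonds at the current site are examined in a fixed order (an injective ranking `rk` of the edges), and
only bonds carrying a non-zero current are examined (zero bonds below the examined one are recorded as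
*skipped*, so that every site *touched* by the walk — visited, or the far end of an attempted bond — lies in
the cluster of the starting point). The walk is a function `Current.explore rk n Y a` of the current; its
value (an `XState`) records the final site, the set of examined-or-skipped bonds `used`, the parity
pattern `pat` of `n` on them, the visited sites `vis` and the touched sites `tch`.

## Main statements (all `[folklore]` reformulations of Aizenman 1982, §9)

* `Current.explore_congr` / `Current.exploreAt_congr` (**locality**): the walk only reads the classes
  `cls (n e)` (zero / odd / even positive) of the bonds it uses — two currents with the same classes on
  `(explore rk n Y a).used` have the same exploration (the identity behind Lemma 9.1 / eq. (9.8): the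
  bonds off `B(ω)` are free).
* `Current.pat_explore` (and `Current.pat_exploreAt`): the recorded pattern is `cls ∘ n` on the used bonds.
* `Current.explore_target_congr` / `Current.exploreAt_target_congr`: enlarging the target by sites the
  walk does not visit changes nothing.
* `Current.tch_explore_subset_cluster` (`Current.mem_cluster_of_mem_tch`): touched sites lie in the
  cluster `C_n(a)`.
* `Current.exists_mem_vis_of_mem_used_explore`, `Current.mem_tch_of_mem_used_explore`: a used bond has a
  visited end; an examined bond (used, non-zero current) has both ends touched.
* `Current.even_travAt_exploreAt` (with `Current.odd_degree_iff_odd_travAt`,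
  `Current.sources_eq_of_cls_eq`): the traversed bonds form a trail from `a` to the current site (odd
  traversal count exactly at `a` and at the current site), so the pattern part has sources
  `{a} ∆ {final site}`.
* `Current.explore_done_of_sources_eq` (**Aizenman's observation**, p. 23): if `∂n = {a} ∆ {b}` the
  walk from `a` with target `{b}` stops at `b` (`Current.pos_eq_of_availAt_eq_empty`,
  `Current.le_card_used_exploreAt`).

## References

* M. Aizenman, Comm. Math. Phys. 86 (1982) 1–48, §9 (pp. 23–27): the walk (i)–(iv), Lemma 9.1,
  Prop. 9.2, Def. 9.2, Prop. 9.3, Lemmas 9.2–9.3 [AizenmanCMP1982].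
-/

noncomputable section

open Finset
open scoped symmDiff

namespace Literature.Probability.LatticeModels

variable {V : Type*} [Fintype V] [DecidableEq V] {G : SimpleGraph V} [DecidableRel G.Adj]

namespace Current

/-! ### Classes of bond values, the other endpoint -/

/-- The class of a bond value read by the walk: `0` for `n_b = 0` (skipped), `1` for `n_b` odd
(traversed), `2` for `n_b` even and positive (attempted). [folklore] -/
def cls (k : ℕ) : Fin 3 := if k = 0 then 0 else if Odd k then 1 else 2

/-- Bookkeeping lemma for the exploration. [folklore] -/
@[simp] theorem cls_zero : cls 0 = 0 := by simp [cls]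

/-- Bookkeeping lemma for the exploration. [folklore] -/
theorem cls_eq_zero_iff {k : ℕ} : cls k = 0 ↔ k = 0 := by
  unfold cls; split_ifs with h1 h2 <;> simp [h1]

/-- Bookkeeping lemma for the exploration. [folklore] -/
theorem cls_eq_one_iff {k : ℕ} : cls k = 1 ↔ Odd k := by
  unfold cls
  split_ifs with h1 h2
  · subst h1; simp
  · simp [h2]
  · simp [h2]

/-- Bookkeeping lemma for the exploration. [folklore] -/
theorem ne_zero_of_cls_eq {k k' : ℕ} (h : cls k' = cls k) (hk : k ≠ 0) : k' ≠ 0 := fun h0 => by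
  rw [h0, cls_zero, eq_comm, cls_eq_zero_iff] at h; exact hk h

/-- Bookkeeping lemma for the exploration. [folklore] -/
theorem odd_iff_of_cls_eq {k k' : ℕ} (h : cls k' = cls k) : Odd k' ↔ Odd k := by
  rw [← cls_eq_one_iff, ← cls_eq_one_iff, h]

/-- Bookkeeping lemma for the exploration. [folklore] -/
theorem eq_zero_iff_of_cls_eq {k k' : ℕ} (h : cls k' = cls k) : k' = 0 ↔ k = 0 := by
  rw [← cls_eq_zero_iff, ← cls_eq_zero_iff, h]

/-- The other endpoint of the bond `e` seen from `v` (`v` itself if `v ∉ e`). [folklore] -/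
def otherEnd (e : G.edgeFinset) (v : V) : V :=
  if h : v ∈ (e : Sym2 V) then Sym2.Mem.other' h else v

/-- Bookkeeping lemma for the exploration. [folklore] -/
theorem otherEnd_spec {e : G.edgeFinset} {v : V} (h : v ∈ (e : Sym2 V)) :
    s(v, otherEnd e v) = (e : Sym2 V) := by
  rw [otherEnd, dif_pos h]; exact Sym2.other_spec' h

/-- Bookkeeping lemma for the exploration. [folklore] -/
theorem otherEnd_mem (e : G.edgeFinset) (v : V) (h : v ∈ (e : Sym2 V)) : otherEnd e v ∈ (e : Sym2 V) := by
  rw [otherEnd, dif_pos h]; exact Sym2.other_mem' h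

/-- Bookkeeping lemma for the exploration. [folklore] -/
theorem adj_otherEnd {e : G.edgeFinset} {v : V} (h : v ∈ (e : Sym2 V)) : G.Adj v (otherEnd e v) := by
  have he : (e : Sym2 V) ∈ G.edgeSet := SimpleGraph.mem_edgeFinset.mp e.2
  rw [← otherEnd_spec h] at he
  exact he

/-- Bookkeeping lemma for the exploration. [folklore] -/
theorem otherEnd_ne {e : G.edgeFinset} {v : V} (h : v ∈ (e : Sym2 V)) : otherEnd e v ≠ v :=
  (adj_otherEnd h).ne'

/-- Bookkeeping lemma for the exploration. [folklore] -/
theorem mem_iff_eq_or_eq_otherEnd {e : G.edgeFinset} {v : V} (h : v ∈ (e : Sym2 V)) (w : V) :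
    w ∈ (e : Sym2 V) ↔ w = v ∨ w = otherEnd e v := by
  rw [← otherEnd_spec h, Sym2.mem_iff]

/-! ### States of the walk and one step -/

/-- A state of the exploration: current site `pos`, used bonds (examined or skipped) `used`, the recorded
classes `pat` of the used bonds, visited sites `vis`, touched sites `tch` (visited sites and far ends of
examined bonds), and the halting flag `done`. [folklore] -/
structure XState (G : SimpleGraph V) [DecidableRel G.Adj] where
  /-- current site -/
  pos : V
  /-- used bonds -/
  used : Finset G.edgeFinset
  /-- recorded classes of the used bonds -/
  pat : G.edgeFinset → Fin 3
  /-- visited sites -/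
  vis : Finset V
  /-- touched sites -/
  tch : Finset V
  /-- halting flag -/
  done : Bool
  deriving DecidableEq

/-- States form a finite type. [folklore] -/
instance XState.instFintype : Fintype (XState G) :=
  Fintype.ofEquiv (V × Finset G.edgeFinset × (G.edgeFinset → Fin 3) × Finset V × Finset V × Bool)
    { toFun := fun p => ⟨p.1, p.2.1, p.2.2.1, p.2.2.2.1, p.2.2.2.2.1, p.2.2.2.2.2⟩
      invFun := fun s => (s.pos, s.used, s.pat, s.vis, s.tch, s.done)
      left_inv := fun _ => rfl
      right_inv := fun _ => rfl }

variable (rk : G.edgeFinset → ℕ) (n : Current G) (Y : Finset V)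

/-- The initial state of the walk started at `a`. [folklore] -/
def xinit (a : V) : XState G :=
  { pos := a, used := ∅, pat := fun _ => 0, vis := {a}, tch := {a}, done := false }

/-- The unused bonds at the current site. [folklore] -/
def unusedAt (s : XState G) : Finset G.edgeFinset :=
  univ.filter fun e => s.pos ∈ (e : Sym2 V) ∧ e ∉ s.used

/-- The bonds the walk may examine: unused bonds at the current site carrying a non-zero current
(Aizenman 1982, §9 (ii), restricted to `n_b ≠ 0`). [folklore] -/
def availAt (s : XState G) : Finset G.edgeFinset := (unusedAt s).filter fun e => n e ≠ 0

variable {rk n} in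
/-- The examination of the bond `e` from the state `s` (Aizenman 1982, §9 (iii)): `e` and the unused
bonds at the current site ranked below it are marked used and their classes recorded; if `n_e` is odd the
walk moves to the other end of `e`, otherwise it stays; the far end of `e` is touched. [folklore] -/
def advance (s : XState G) (e : G.edgeFinset) : XState G :=
  { pos := if Odd (n e) then otherEnd e s.pos else s.pos
    used := s.used ∪ (unusedAt s).filter fun e' => rk e' ≤ rk e
    pat := fun e' => if e' ∈ (unusedAt s).filter (fun e' => rk e' ≤ rk e) then cls (n e') else s.pat e'
    vis := insert (if Odd (n e) then otherEnd e s.pos else s.pos) s.vis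
    tch := insert (otherEnd e s.pos) s.tch
    done := false }

/-- One step of the walk with target set `Y` (Aizenman 1982, §9 (ii)–(iv)): a halted state is fixed; at a
site of `Y` the walk halts; otherwise it examines the available bond of least rank, and if there is none it
marks the (zero) unused bonds at the site and halts. [folklore] -/
def xstep (s : XState G) : XState G :=
  if s.done then s
  else if s.pos ∈ Y then { s with done := true }
  else if h : (availAt n s).Nonempty then
    advance (rk := rk) (n := n) s (Function.argminOn rk (↑(availAt n s) : Set G.edgeFinset) h)
  else
    { s with
      used := s.used ∪ unusedAt s
      pat := fun e' => if e' ∈ unusedAt s then 0 else s.pat e'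
      done := true }

/-- The walk: `|E| + 1` steps from the initial state at `a`. [folklore] -/
def explore (a : V) : XState G := (xstep rk n Y)^[Fintype.card G.edgeFinset + 1] (xinit a)

/-- The `k`-th state of the walk. [folklore] -/
def exploreAt (a : V) (k : ℕ) : XState G := (xstep rk n Y)^[k] (xinit a)

/-- Bookkeeping lemma for the exploration. [folklore] -/
theorem exploreAt_zero (a : V) : exploreAt rk n Y a 0 = xinit a := rfl

/-- Bookkeeping lemma for the exploration. [folklore] -/
theorem exploreAt_succ (a : V) (k : ℕ) :
    exploreAt rk n Y a (k + 1) = xstep rk n Y (exploreAt rk n Y a k) :=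
  Function.iterate_succ_apply' _ _ _

/-- Bookkeeping lemma for the exploration. [folklore] -/
theorem explore_eq_exploreAt (a : V) :
    explore rk n Y a = exploreAt rk n Y a (Fintype.card G.edgeFinset + 1) := rfl


/-! ### Case analysis of one step -/

section Step

variable {rk n Y}

/-- The stuck state: the unused bonds at the site (all zero) are marked and the walk halts. [folklore] -/
def stuck (s : XState G) : XState G :=
  { s with
    used := s.used ∪ unusedAt s
    pat := fun e' => if e' ∈ unusedAt s then 0 else s.pat e'
    done := true }

/-- Bookkeeping lemma for the exploration. [folklore] -/
theorem xstep_of_done {s : XState G} (h : s.done = true) : xstep rk n Y s = s := by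
  simp [xstep, h]

/-- Bookkeeping lemma for the exploration. [folklore] -/
theorem xstep_of_mem {s : XState G} (h : s.done = false) (hY : s.pos ∈ Y) :
    xstep rk n Y s = { s with done := true } := by
  simp [xstep, h, hY]

/-- Bookkeeping lemma for the exploration. [folklore] -/
theorem xstep_of_nonempty {s : XState G} (h : s.done = false) (hY : s.pos ∉ Y)
    (hA : (availAt n s).Nonempty) :
    xstep rk n Y s = advance (rk := rk) (n := n) s
      (Function.argminOn rk (↑(availAt n s) : Set G.edgeFinset) hA) := by
  simp [xstep, h, hY, hA]

/-- Bookkeeping lemma for the exploration. [folklore] -/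
theorem xstep_of_empty {s : XState G} (h : s.done = false) (hY : s.pos ∉ Y)
    (hA : ¬ (availAt n s).Nonempty) : xstep rk n Y s = stuck s := by
  simp [xstep, h, hY, hA, stuck]

/-- The four cases of a step. [folklore] -/
theorem xstep_cases (s : XState G) :
    (s.done = true ∧ xstep rk n Y s = s) ∨
    (s.done = false ∧ s.pos ∈ Y ∧ xstep rk n Y s = { s with done := true }) ∨
    (s.done = false ∧ s.pos ∉ Y ∧ ∃ hA : (availAt n s).Nonempty, xstep rk n Y s =
      advance (rk := rk) (n := n) s (Function.argminOn rk (↑(availAt n s) : Set G.edgeFinset) hA)) ∨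
    (s.done = false ∧ s.pos ∉ Y ∧ availAt n s = ∅ ∧ xstep rk n Y s = stuck s) := by
  by_cases h : s.done = true
  · exact Or.inl ⟨h, xstep_of_done h⟩
  rw [Bool.not_eq_true] at h
  by_cases hY : s.pos ∈ Y
  · exact Or.inr (Or.inl ⟨h, hY, xstep_of_mem h hY⟩)
  by_cases hA : (availAt n s).Nonempty
  · exact Or.inr (Or.inr (Or.inl ⟨h, hY, hA, xstep_of_nonempty h hY hA⟩))
  · exact Or.inr (Or.inr (Or.inr ⟨h, hY, not_nonempty_iff_eq_empty.mp hA, xstep_of_empty h hY hA⟩))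

/-- Bookkeeping lemma for the exploration. [folklore] -/
theorem mem_unusedAt {s : XState G} {e : G.edgeFinset} :
    e ∈ unusedAt s ↔ s.pos ∈ (e : Sym2 V) ∧ e ∉ s.used := by
  simp [unusedAt]

/-- Bookkeeping lemma for the exploration. [folklore] -/
theorem mem_availAt {s : XState G} {e : G.edgeFinset} :
    e ∈ availAt n s ↔ (s.pos ∈ (e : Sym2 V) ∧ e ∉ s.used) ∧ n e ≠ 0 := by
  simp [availAt, unusedAt]

/-- The examined bond is available, and no available bond has smaller rank. [folklore] -/
theorem argminOn_mem_availAt {s : XState G} (hA : (availAt n s).Nonempty) :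
    Function.argminOn rk (↑(availAt n s) : Set G.edgeFinset) hA ∈ availAt n s :=
  Function.argminOn_mem rk _ hA

/-- Bookkeeping lemma for the exploration. [folklore] -/
theorem rk_argminOn_le {s : XState G} (hA : (availAt n s).Nonempty) {e : G.edgeFinset}
    (he : e ∈ availAt n s) :
    rk (Function.argminOn rk (↑(availAt n s) : Set G.edgeFinset) hA) ≤ rk e :=
  Function.argminOn_le rk (↑(availAt n s) : Set G.edgeFinset) (Finset.mem_coe.mpr he)

/-- A bond marked together with the examined bond `e` is either `e`-ranked or a zero bond: if it
carries a non-zero current its rank is not below that of `e`. [folklore] -/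
theorem apply_eq_zero_of_rk_lt {s : XState G} (hA : (availAt n s).Nonempty) {e' : G.edgeFinset}
    (he' : e' ∈ unusedAt s)
    (hlt : rk e' < rk (Function.argminOn rk (↑(availAt n s) : Set G.edgeFinset) hA)) : n e' = 0 := by
  by_contra hne
  exact absurd (rk_argminOn_le (rk := rk) hA (mem_availAt.mpr ⟨mem_unusedAt.mp he', hne⟩)) (not_le.mpr hlt)

/-! ### Monotonicity and bookkeeping of one step -/

/-- `advance` only adds used bonds. [folklore] -/
theorem used_subset_advance (s : XState G) (e : G.edgeFinset) :
    s.used ⊆ (advance (rk := rk) (n := n) s e).used := subset_union_left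

/-- Bookkeeping lemma for the exploration. [folklore] -/
theorem used_subset_xstep (s : XState G) : s.used ⊆ (xstep rk n Y s).used := by
  rcases xstep_cases (rk := rk) (n := n) (Y := Y) s with ⟨-, h⟩ | ⟨-, -, h⟩ | ⟨-, -, hA, h⟩ | ⟨-, -, -, h⟩ <;>
    rw [h]
  · exact used_subset_advance s _
  · exact subset_union_left

/-- Bookkeeping lemma for the exploration. [folklore] -/
theorem vis_subset_xstep (s : XState G) : s.vis ⊆ (xstep rk n Y s).vis := by
  rcases xstep_cases (rk := rk) (n := n) (Y := Y) s with ⟨-, h⟩ | ⟨-, -, h⟩ | ⟨-, -, hA, h⟩ | ⟨-, -, -, h⟩ <;>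
    rw [h]
  · exact subset_insert _ _
  · rfl

/-- Bookkeeping lemma for the exploration. [folklore] -/
theorem tch_subset_xstep (s : XState G) : s.tch ⊆ (xstep rk n Y s).tch := by
  rcases xstep_cases (rk := rk) (n := n) (Y := Y) s with ⟨-, h⟩ | ⟨-, -, h⟩ | ⟨-, -, hA, h⟩ | ⟨-, -, -, h⟩ <;>
    rw [h]
  · exact subset_insert _ _
  · rfl

/-- Bookkeeping lemma for the exploration. [folklore] -/
theorem done_xstep_of_done {s : XState G} (h : s.done = true) : (xstep rk n Y s).done = true := by
  rw [xstep_of_done h]; exact h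

/-- The pattern of a previously used bond is not changed by a step. [folklore] -/
theorem pat_xstep_of_mem {s : XState G} {e : G.edgeFinset} (he : e ∈ s.used) :
    (xstep rk n Y s).pat e = s.pat e := by
  rcases xstep_cases (rk := rk) (n := n) (Y := Y) s with ⟨-, h⟩ | ⟨-, -, h⟩ | ⟨-, -, hA, h⟩ | ⟨-, -, -, h⟩ <;>
    rw [h]
  · simp only [advance]
    rw [if_neg]
    simp [mem_unusedAt, he]
  · simp only [stuck]
    rw [if_neg]
    simp [mem_unusedAt, he]

/-- A bond used for the first time in a step gets the class of its current recorded. [folklore] -/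
theorem pat_xstep_of_not_mem {s : XState G} {e : G.edgeFinset} (he : e ∉ s.used)
    (he' : e ∈ (xstep rk n Y s).used) : (xstep rk n Y s).pat e = cls (n e) := by
  rcases xstep_cases (rk := rk) (n := n) (Y := Y) s with ⟨-, h⟩ | ⟨-, -, h⟩ | ⟨-, -, hA, h⟩ | ⟨-, -, hA, h⟩ <;>
    rw [h] at he' ⊢
  · exact absurd he' he
  · exact absurd he' he
  · simp only [advance, mem_union] at he' ⊢
    rcases he' with he' | he'
    · exact absurd he' he
    · rw [if_pos he']
  · simp only [stuck, mem_union] at he' ⊢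
    rcases he' with he' | he'
    · exact absurd he' he
    · rw [if_pos he']
      have : e ∉ availAt n s := by rw [hA]; exact notMem_empty e
      rw [mem_availAt, not_and, not_not] at this
      rw [this (mem_unusedAt.mp he'), cls_zero]

/-- A bond used for the first time in a step contains the current site. [folklore] -/
theorem pos_mem_of_mem_used_xstep {s : XState G} {e : G.edgeFinset} (he : e ∉ s.used)
    (he' : e ∈ (xstep rk n Y s).used) : s.pos ∈ (e : Sym2 V) := by
  rcases xstep_cases (rk := rk) (n := n) (Y := Y) s with ⟨-, h⟩ | ⟨-, -, h⟩ | ⟨-, -, hA, h⟩ | ⟨-, -, hA, h⟩ <;>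
    rw [h] at he'
  · exact absurd he' he
  · exact absurd he' he
  · simp only [advance, mem_union, mem_filter] at he'
    rcases he' with he' | ⟨he', -⟩
    · exact absurd he' he
    · exact (mem_unusedAt.mp he').1
  · simp only [stuck, mem_union] at he'
    rcases he' with he' | he'
    · exact absurd he' he
    · exact (mem_unusedAt.mp he').1

/-- A bond used for the first time in a step and carrying a non-zero current is the examined bond:
its far end is touched and, if the current is odd, becomes the current site. [folklore] -/
theorem eq_argminOn_of_mem_used_xstep (hrk : Function.Injective rk) {s : XState G} {e : G.edgeFinset}
    (he : e ∉ s.used) (he' : e ∈ (xstep rk n Y s).used) (hne : n e ≠ 0) :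
    ∃ (_ : s.done = false) (_ : s.pos ∉ Y) (hA : (availAt n s).Nonempty),
      e = Function.argminOn rk (↑(availAt n s) : Set G.edgeFinset) hA := by
  rcases xstep_cases (rk := rk) (n := n) (Y := Y) s with ⟨-, h⟩ | ⟨-, -, h⟩ | ⟨hd, hY, hA, h⟩ | ⟨-, -, hA, h⟩ <;>
    rw [h] at he'
  · exact absurd he' he
  · exact absurd he' he
  · refine ⟨hd, hY, hA, ?_⟩
    simp only [advance, mem_union, mem_filter] at he'
    rcases he' with he' | ⟨he', hle⟩
    · exact absurd he' he
    rcases hle.lt_or_eq with hlt | heq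
    · exact absurd (apply_eq_zero_of_rk_lt hA he' hlt) hne
    · exact hrk heq
  · simp only [stuck, mem_union] at he'
    rcases he' with he' | he'
    · exact absurd he' he
    · have : e ∉ availAt n s := by rw [hA]; exact notMem_empty e
      rw [mem_availAt, not_and, not_not] at this
      exact absurd (this (mem_unusedAt.mp he')) hne

end Step


/-! ### Invariants of the walk -/

section Run

variable {rk n Y}

/-- Bookkeeping lemma for the exploration. [folklore] -/
theorem done_exploreAt_mono {a : V} {k k' : ℕ} (hk : k ≤ k') (h : (exploreAt rk n Y a k).done = true) :
    (exploreAt rk n Y a k').done = true := by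
  induction hk with
  | refl => exact h
  | step _ ih => rw [exploreAt_succ]; exact done_xstep_of_done ih

/-- Bookkeeping lemma for the exploration. [folklore] -/
theorem used_exploreAt_mono {a : V} {k k' : ℕ} (hk : k ≤ k') :
    (exploreAt rk n Y a k).used ⊆ (exploreAt rk n Y a k').used := by
  induction hk with
  | refl => rfl
  | step _ ih => rw [exploreAt_succ]; exact ih.trans (used_subset_xstep _)

/-- Bookkeeping lemma for the exploration. [folklore] -/
theorem vis_exploreAt_mono {a : V} {k k' : ℕ} (hk : k ≤ k') :
    (exploreAt rk n Y a k).vis ⊆ (exploreAt rk n Y a k').vis := by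
  induction hk with
  | refl => rfl
  | step _ ih => rw [exploreAt_succ]; exact ih.trans (vis_subset_xstep _)

/-- Bookkeeping lemma for the exploration. [folklore] -/
theorem tch_exploreAt_mono {a : V} {k k' : ℕ} (hk : k ≤ k') :
    (exploreAt rk n Y a k).tch ⊆ (exploreAt rk n Y a k').tch := by
  induction hk with
  | refl => rfl
  | step _ ih => rw [exploreAt_succ]; exact ih.trans (tch_subset_xstep _)

/-- **The recorded pattern is the class of the current** on every used bond. [folklore] -/
theorem pat_exploreAt (a : V) (k : ℕ) {e : G.edgeFinset} (he : e ∈ (exploreAt rk n Y a k).used) :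
    (exploreAt rk n Y a k).pat e = cls (n e) := by
  induction k with
  | zero => simp [exploreAt_zero, xinit] at he
  | succ k ih =>
    rw [exploreAt_succ] at he ⊢
    by_cases h : e ∈ (exploreAt rk n Y a k).used
    · rw [pat_xstep_of_mem h, ih h]
    · exact pat_xstep_of_not_mem h he

/-- The current site is visited, the start is visited, visited sites are touched. [folklore] -/
theorem pos_mem_vis_exploreAt (a : V) (k : ℕ) :
    (exploreAt rk n Y a k).pos ∈ (exploreAt rk n Y a k).vis ∧ a ∈ (exploreAt rk n Y a k).vis ∧
      (exploreAt rk n Y a k).vis ⊆ (exploreAt rk n Y a k).tch := by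
  induction k with
  | zero => simp [exploreAt_zero, xinit]
  | succ k ih =>
    obtain ⟨h1, h2, h3⟩ := ih
    rw [exploreAt_succ]
    set s := exploreAt rk n Y a k
    rcases xstep_cases (rk := rk) (n := n) (Y := Y) s with ⟨-, h⟩ | ⟨-, -, h⟩ | ⟨-, -, hA, h⟩ | ⟨-, -, -, h⟩ <;>
      rw [h]
    · exact ⟨h1, h2, h3⟩
    · exact ⟨h1, h2, h3⟩
    · refine ⟨mem_insert_self _ _, mem_insert_of_mem h2, ?_⟩
      simp only [advance]
      refine insert_subset_iff.mpr ⟨?_, h3.trans (subset_insert _ _)⟩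
      split_ifs
      · exact mem_insert_self _ _
      · exact mem_insert_of_mem (h3 h1)
    · exact ⟨h1, h2, h3⟩

/-- Bookkeeping lemma for the exploration. [folklore] -/
theorem pos_mem_vis_explore (a : V) : (explore rk n Y a).pos ∈ (explore rk n Y a).vis :=
  (pos_mem_vis_exploreAt a _).1

/-- Bookkeeping lemma for the exploration. [folklore] -/
theorem start_mem_vis_explore (a : V) : a ∈ (explore rk n Y a).vis :=
  (pos_mem_vis_exploreAt a _).2.1

/-- Bookkeeping lemma for the exploration. [folklore] -/
theorem vis_subset_tch_explore (a : V) : (explore rk n Y a).vis ⊆ (explore rk n Y a).tch :=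
  (pos_mem_vis_exploreAt a _).2.2

/-- Every site the walk passes through is visited at the end. [folklore] -/
theorem pos_exploreAt_mem_vis_explore (a : V) {k : ℕ} (hk : k ≤ Fintype.card G.edgeFinset + 1) :
    (exploreAt rk n Y a k).pos ∈ (explore rk n Y a).vis :=
  vis_exploreAt_mono hk (pos_mem_vis_exploreAt a k).1

/-- **Every used bond contains a visited site.** [folklore] -/
theorem exists_mem_vis_of_mem_used (a : V) (k : ℕ) {e : G.edgeFinset}
    (he : e ∈ (exploreAt rk n Y a k).used) : ∃ v ∈ (exploreAt rk n Y a k).vis, v ∈ (e : Sym2 V) := by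
  induction k with
  | zero => simp [exploreAt_zero, xinit] at he
  | succ k ih =>
    rw [exploreAt_succ] at he ⊢
    by_cases h : e ∈ (exploreAt rk n Y a k).used
    · obtain ⟨v, hv, hve⟩ := ih h
      exact ⟨v, vis_subset_xstep _ hv, hve⟩
    · exact ⟨_, vis_subset_xstep _ (pos_mem_vis_exploreAt a k).1, pos_mem_of_mem_used_xstep h he⟩

/-- **An examined bond (a used bond with non-zero current) has both ends touched.** [folklore] -/
theorem mem_tch_of_mem_used (hrk : Function.Injective rk) (a : V) (k : ℕ) {e : G.edgeFinset}
    (he : e ∈ (exploreAt rk n Y a k).used) (hne : n e ≠ 0) {w : V} (hw : w ∈ (e : Sym2 V)) :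
    w ∈ (exploreAt rk n Y a k).tch := by
  induction k with
  | zero => simp [exploreAt_zero, xinit] at he
  | succ k ih =>
    rw [exploreAt_succ] at he ⊢
    by_cases h : e ∈ (exploreAt rk n Y a k).used
    · exact tch_subset_xstep _ (ih h)
    · set s := exploreAt rk n Y a k
      obtain ⟨hd, hY, hA, rfl⟩ := eq_argminOn_of_mem_used_xstep hrk h he hne
      have hpos : s.pos ∈ (↑(Function.argminOn rk (↑(availAt n s) : Set G.edgeFinset) hA) : Sym2 V) :=
        (mem_availAt.mp (argminOn_mem_availAt hA)).1.1
      rw [xstep_of_nonempty hd hY hA]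
      rcases (mem_iff_eq_or_eq_otherEnd hpos w).mp hw with rfl | rfl
      · simp only [advance]
        refine mem_insert_of_mem ((pos_mem_vis_exploreAt a k).2.2 ?_)
        exact (pos_mem_vis_exploreAt (rk := rk) (n := n) (Y := Y) a k).1
      · exact mem_insert_self _ _

/-- **Touched sites lie in the cluster of the start.** [folklore] -/
theorem mem_cluster_of_mem_tch (a : V) (k : ℕ) {v : V} (hv : v ∈ (exploreAt rk n Y a k).tch) :
    v ∈ n.cluster a := by
  induction k generalizing v with
  | zero =>
    simp only [exploreAt_zero, xinit, mem_singleton] at hv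
    rw [hv]; exact mem_cluster_self n a
  | succ k ih =>
    rw [exploreAt_succ] at hv
    set s := exploreAt rk n Y a k
    rcases xstep_cases (rk := rk) (n := n) (Y := Y) s with ⟨-, h⟩ | ⟨-, -, h⟩ | ⟨-, -, hA, h⟩ | ⟨-, -, -, h⟩ <;>
      rw [h] at hv
    · exact ih hv
    · exact ih hv
    · simp only [advance, mem_insert] at hv
      rcases hv with rfl | hv
      · have hm := mem_availAt.mp (argminOn_mem_availAt (rk := rk) hA)
        have hpos : s.pos ∈ n.cluster a := ih ((pos_mem_vis_exploreAt a k).2.2 (pos_mem_vis_exploreAt a k).1)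
        exact forall_mem_cluster_of_pos (Nat.pos_of_ne_zero hm.2) hm.1.1 hpos _ (otherEnd_mem _ _ hm.1.1)
      · exact ih hv
    · exact ih hv

end Run


/-! ### The traversed bonds form a trail from the start to the current site -/

section Trail

variable {rk n Y}

/-- The number of traversed bonds (used bonds with odd current) at the site `v`. [folklore] -/
def travAt (n : Current G) (s : XState G) (v : V) : ℕ :=
  ∑ e ∈ s.used, if Odd (n e) ∧ v ∈ (e : Sym2 V) then 1 else 0

/-- Bookkeeping lemma for the exploration. [folklore] -/
theorem travAt_xinit (a v : V) : travAt n (xinit (G := G) a) v = 0 := by simp [travAt, xinit]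

/-- One step changes the traversal count at `v` and the indicator of the current site by an even
amount. [folklore] -/
theorem even_travAt_xstep_add (hrk : Function.Injective rk) (s : XState G) (v : V) :
    Even (travAt n (xstep rk n Y s) v + (if v = (xstep rk n Y s).pos then 1 else 0) +
      (travAt n s v + (if v = s.pos then 1 else 0))) := by
  rcases xstep_cases (rk := rk) (n := n) (Y := Y) s with ⟨-, h⟩ | ⟨-, -, h⟩ | ⟨-, -, hA, h⟩ | ⟨-, -, hA, h⟩ <;>
    rw [h]
  · exact ⟨_, rfl⟩
  · exact ⟨travAt n s v + (if v = s.pos then 1 else 0), rfl⟩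
  · set e := Function.argminOn rk (↑(availAt n s) : Set G.edgeFinset) hA with he_def
    set M := (unusedAt s).filter fun e' => rk e' ≤ rk e with hM
    have heA : (s.pos ∈ (e : Sym2 V) ∧ e ∉ s.used) ∧ n e ≠ 0 :=
      mem_availAt.mp (argminOn_mem_availAt (rk := rk) hA)
    have heM : e ∈ M := mem_filter.mpr ⟨mem_unusedAt.mpr heA.1, le_rfl⟩
    have hdisj : Disjoint s.used M := by
      rw [Finset.disjoint_left]
      intro e' he' hM'
      exact (mem_unusedAt.mp (mem_filter.mp hM').1).2 he'
    have hsumM : (∑ e' ∈ M, if Odd (n e') ∧ v ∈ (e' : Sym2 V) then 1 else 0 : ℕ) =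
        if Odd (n e) ∧ v ∈ (e : Sym2 V) then 1 else 0 := by
      refine Finset.sum_eq_single_of_mem e heM fun e' he' hne => ?_
      have hle := (mem_filter.mp he').2
      rcases hle.lt_or_eq with hlt | heq
      · simp [apply_eq_zero_of_rk_lt hA (mem_filter.mp he').1 hlt]
      · exact absurd (hrk heq) hne
    have htrav : travAt n (advance (rk := rk) (n := n) s e) v =
        travAt n s v + if Odd (n e) ∧ v ∈ (e : Sym2 V) then 1 else 0 := by
      simp only [travAt, advance]
      rw [Finset.sum_union hdisj, hsumM]
    rw [htrav]
    simp only [advance]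
    by_cases ho : Odd (n e)
    · simp only [ho, true_and, if_true]
      have hne : otherEnd e s.pos ≠ s.pos := otherEnd_ne heA.1.1
      by_cases hv1 : v = s.pos
      · subst hv1
        simp only [if_true, if_neg hne.symm, if_pos heA.1.1]
        exact ⟨travAt n s s.pos + 1, by ring⟩
      · by_cases hv2 : v = otherEnd e s.pos
        · subst hv2
          simp only [if_true, if_neg hv1, if_pos (otherEnd_mem e s.pos heA.1.1)]
          exact ⟨travAt n s (otherEnd e s.pos) + 1, by ring⟩
        · have hv : v ∉ (e : Sym2 V) := fun h =>
            ((mem_iff_eq_or_eq_otherEnd heA.1.1 v).mp h).elim hv1 hv2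
          simp only [if_neg hv1, if_neg hv2, if_neg hv]
          exact ⟨travAt n s v, by ring⟩
    · simp only [ho, false_and, if_false]
      exact ⟨travAt n s v + (if v = s.pos then 1 else 0), by ring⟩
  · have hM : (∑ e' ∈ unusedAt s, if Odd (n e') ∧ v ∈ (e' : Sym2 V) then 1 else 0 : ℕ) = 0 := by
      refine Finset.sum_eq_zero fun e' he' => ?_
      have : e' ∉ availAt n s := by rw [hA]; exact notMem_empty e'
      rw [mem_availAt, not_and, not_not] at this
      simp [this (mem_unusedAt.mp he')]
    have hdisj : Disjoint s.used (unusedAt s) := by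
      rw [Finset.disjoint_left]
      intro e' he' hM'
      exact (mem_unusedAt.mp hM').2 he'
    have htrav : travAt n (stuck s) v = travAt n s v := by
      simp only [travAt, stuck]
      rw [Finset.sum_union hdisj, hM, add_zero]
    rw [htrav]
    exact ⟨travAt n s v + (if v = s.pos then 1 else 0), rfl⟩

end Trail


section TrailRun

variable {rk n Y}

/-- **The traversed bonds form a trail from the start `a` to the current site**: every site has an
even number of traversed bonds at it, except `a` and the current site (when different), which have an
odd number. [folklore] -/
theorem even_travAt_exploreAt (hrk : Function.Injective rk) (a : V) (k : ℕ) (v : V) :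
    Even (travAt n (exploreAt rk n Y a k) v + (if v = a then 1 else 0) +
      (if v = (exploreAt rk n Y a k).pos then 1 else 0)) := by
  induction k with
  | zero =>
    rw [exploreAt_zero, travAt_xinit]
    simp only [xinit]
    split_ifs
    · exact ⟨1, rfl⟩
    · exact ⟨0, rfl⟩
  | succ k ih =>
    have h := even_travAt_xstep_add (n := n) (Y := Y) hrk (exploreAt rk n Y a k) v
    rw [← exploreAt_succ] at h
    rw [Nat.even_iff] at ih h ⊢
    omega

/-- While the walk has not halted it has used at least as many bonds as steps taken. [folklore] -/
theorem le_card_used_exploreAt (a : V) (k : ℕ) (h : (exploreAt rk n Y a k).done = false) :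
    k ≤ (exploreAt rk n Y a k).used.card := by
  induction k with
  | zero => exact Nat.zero_le _
  | succ k ih =>
    have hk : (exploreAt rk n Y a k).done = false := by
      by_contra hc
      rw [Bool.not_eq_false] at hc
      have := done_exploreAt_mono (Nat.le_succ k) hc
      rw [h] at this; exact Bool.false_ne_true this
    have ih' := ih hk
    rw [exploreAt_succ] at h ⊢
    set s := exploreAt rk n Y a k
    rcases xstep_cases (rk := rk) (n := n) (Y := Y) s with ⟨hd, -⟩ | ⟨-, -, hs⟩ | ⟨-, -, hA, hs⟩ | ⟨-, -, -, hs⟩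
    · rw [hk] at hd; exact absurd hd Bool.false_ne_true
    · rw [hs] at h; simp at h
    · rw [hs]
      have heA := mem_availAt.mp (argminOn_mem_availAt (rk := rk) hA)
      have hss : s.used ⊂ (advance (rk := rk) (n := n) s
          (Function.argminOn rk (↑(availAt n s) : Set G.edgeFinset) hA)).used := by
        refine Finset.ssubset_iff_subset_ne.mpr ⟨used_subset_advance _ _, fun heq => heA.1.2 ?_⟩
        rw [heq]
        simp only [advance, mem_union, mem_filter]
        exact Or.inr ⟨mem_unusedAt.mpr heA.1, le_rfl⟩
      have := Finset.card_lt_card hss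
      omega
    · rw [hs] at h; simp [stuck] at h

/-- With no available bond, the parity of the degree of the current site is that of its traversal
count (every bond at the site with odd current has been used, hence traversed). [folklore] -/
theorem odd_degree_iff_odd_travAt {s : XState G} (hA : availAt n s = ∅) :
    Odd (n.degree s.pos) ↔ Odd (travAt n s s.pos) := by
  have hterm : ∀ e : G.edgeFinset, (if s.pos ∈ (e : Sym2 V) then n e else 0) % 2 =
      (if e ∈ s.used then (if Odd (n e) ∧ s.pos ∈ (e : Sym2 V) then 1 else 0) else 0) := by
    intro e
    by_cases hp : s.pos ∈ (e : Sym2 V)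
    · by_cases hu : e ∈ s.used
      · rw [if_pos hp, if_pos hu]
        by_cases ho : Odd (n e)
        · rw [if_pos ⟨ho, hp⟩]; exact Nat.odd_iff.mp ho
        · rw [if_neg (fun h => ho h.1)]; exact Nat.even_iff.mp (Nat.not_odd_iff_even.mp ho)
      · have : e ∉ availAt n s := by rw [hA]; exact notMem_empty e
        rw [mem_availAt, not_and, not_not] at this
        rw [if_pos hp, if_neg hu, this ⟨hp, hu⟩]
    · rw [if_neg hp]
      split_ifs with h1 h2
      · exact absurd h2.2 hp
      · rfl
      · rfl
  rw [Nat.odd_iff, Nat.odd_iff]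
  unfold Current.degree travAt
  rw [Finset.sum_nat_mod, Finset.sum_congr rfl fun e _ => hterm e, Finset.sum_ite_mem, Finset.univ_inter]

/-- **Aizenman's observation** (1982, §9, p. 23): for a current with sources `{a} ∆ {b}` the walk
from `a` is never stuck away from `b` — a site with no available bond is `b`. [cite: AizenmanCMP1982, §9 (p. 23)] -/
theorem pos_eq_of_availAt_eq_empty (hrk : Function.Injective rk) {a b : V}
    (hn : n.sources = {a} ∆ {b}) (k : ℕ) (hA : availAt n (exploreAt rk n Y a k) = ∅) :
    (exploreAt rk n Y a k).pos = b := by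
  have hpar := even_travAt_exploreAt (n := n) (Y := Y) hrk a k (exploreAt rk n Y a k).pos
  rw [if_pos rfl] at hpar
  have hdeg := odd_degree_iff_odd_travAt (n := n) hA
  have hsrc := mem_sources_iff n (exploreAt rk n Y a k).pos
  rw [hn, Finset.mem_symmDiff, mem_singleton, mem_singleton] at hsrc
  set s := exploreAt rk n Y a k
  by_contra hb
  by_cases ha : s.pos = a
  · rw [if_pos ha] at hpar
    have h1 : ¬ Odd (travAt n s s.pos) := by
      rw [Nat.not_odd_iff_even]; rw [Nat.even_iff] at hpar ⊢; omega
    rw [← hdeg, ← hsrc] at h1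
    exact h1 (Or.inl ⟨ha, hb⟩)
  · rw [if_neg ha] at hpar
    have h1 : Odd (travAt n s s.pos) := by
      rw [Nat.odd_iff]; rw [Nat.even_iff] at hpar; omega
    rw [← hdeg, ← hsrc] at h1
    rcases h1 with ⟨h, -⟩ | ⟨h, -⟩
    · exact ha h
    · exact hb h

/-- A halted walk does not move any more. [folklore] -/
theorem exploreAt_eq_of_done {a : V} {k k' : ℕ} (hk : k ≤ k') (h : (exploreAt rk n Y a k).done = true) :
    exploreAt rk n Y a k' = exploreAt rk n Y a k := by
  induction hk with
  | refl => rfl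
  | step hle ih => rw [exploreAt_succ, ih, xstep_of_done h]

/-- **The walk from `a` with target `{b}` halts at `b`** when `∂n = {a} ∆ {b}`
(Aizenman 1982, §9 (iv) and the observation on p. 23). [cite: AizenmanCMP1982, §9 (p. 23)] -/
theorem explore_done_of_sources_eq (hrk : Function.Injective rk) {a b : V}
    (hn : n.sources = {a} ∆ {b}) :
    (explore rk n {b} a).done = true ∧ (explore rk n {b} a).pos = b := by
  set F := Fintype.card G.edgeFinset + 1 with hF
  have hdoneF : (exploreAt rk n {b} a F).done = true := by
    by_contra hc
    rw [Bool.not_eq_true] at hc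
    have h1 := le_card_used_exploreAt (Y := {b}) a F hc
    have h2 : (exploreAt rk n {b} a F).used.card ≤ Fintype.card G.edgeFinset := Finset.card_le_univ _
    omega
  classical
  have hex : ∃ k, (exploreAt rk n {b} a k).done = true := ⟨F, hdoneF⟩
  have hk₀d : (exploreAt rk n {b} a (Nat.find hex)).done = true := Nat.find_spec hex
  have hk₀pos : Nat.find hex ≠ 0 := by
    intro h0
    have := hk₀d
    rw [h0, exploreAt_zero] at this
    simp [xinit] at this
  obtain ⟨k, hk0⟩ := Nat.exists_eq_succ_of_ne_zero hk₀pos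
  rw [hk0] at hk₀d
  have hk : (exploreAt rk n {b} a k).done = false := by
    have := Nat.find_min hex (show k < Nat.find hex by omega)
    simpa using this
  have hk₀F : k + 1 ≤ F := by have := Nat.find_min' hex hdoneF; omega
  have hstep : (exploreAt rk n {b} a (k + 1)).pos = b := by
    rw [exploreAt_succ] at hk₀d ⊢
    set s := exploreAt rk n {b} a k
    rcases xstep_cases (rk := rk) (n := n) (Y := {b}) s with ⟨hd, -⟩ | ⟨-, hY, hs⟩ | ⟨-, -, hA, hs⟩ | ⟨-, hY, hA, hs⟩
    · rw [hk] at hd; exact absurd hd Bool.false_ne_true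
    · rw [hs]; exact mem_singleton.mp hY
    · rw [hs] at hk₀d; simp [advance] at hk₀d
    · exact absurd (pos_eq_of_availAt_eq_empty (Y := {b}) hrk hn k hA) (fun h => hY (mem_singleton.mpr h))
  change (exploreAt rk n {b} a F).done = true ∧ (exploreAt rk n {b} a F).pos = b
  rw [exploreAt_eq_of_done hk₀F hk₀d]
  exact ⟨hk₀d, hstep⟩

end TrailRun


/-! ### Locality: the walk only reads the classes of the bonds it uses -/

section Locality

variable {rk n Y}

/-- Bookkeeping lemma for the exploration. [folklore] -/
theorem unusedAt_eq_of_eq {s s' : XState G} (hp : s'.pos = s.pos) (hu : s'.used = s.used) :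
    unusedAt s' = unusedAt s := by
  simp [unusedAt, hp, hu]

/-- `advance` only reads the classes of the marked bonds. [folklore] -/
theorem advance_congr {n' : Current G} (s : XState G) (e : G.edgeFinset)
    (he : e ∈ (unusedAt s).filter fun e' => rk e' ≤ rk e)
    (h : ∀ e' ∈ (unusedAt s).filter (fun e' => rk e' ≤ rk e), cls (n' e') = cls (n e')) :
    advance (rk := rk) (n := n') s e = advance (rk := rk) (n := n) s e := by
  have hodd : Odd (n' e) ↔ Odd (n e) := odd_iff_of_cls_eq (h e he)
  simp only [advance, hodd]
  congr 1
  funext e'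
  split_ifs with h1
  · exact h (e' ) h1
  · rfl

/-- **One step only reads the classes of the newly used bonds.** [folklore] -/
theorem xstep_congr (hrk : Function.Injective rk) {n' : Current G} (s : XState G)
    (h : ∀ e ∈ (xstep rk n Y s).used, e ∉ s.used → cls (n' e) = cls (n e)) :
    xstep rk n' Y s = xstep rk n Y s := by
  rcases xstep_cases (rk := rk) (n := n) (Y := Y) s with ⟨hd, hs⟩ | ⟨hd, hY, hs⟩ | ⟨hd, hY, hA, hs⟩ | ⟨hd, hY, hA, hs⟩
  · rw [hs, xstep_of_done hd]
  · rw [hs, xstep_of_mem hd hY]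
  · set e := Function.argminOn rk (↑(availAt n s) : Set G.edgeFinset) hA with he
    have heA : (s.pos ∈ (e : Sym2 V) ∧ e ∉ s.used) ∧ n e ≠ 0 :=
      mem_availAt.mp (argminOn_mem_availAt (rk := rk) hA)
    have hM : ∀ e' ∈ (unusedAt s).filter (fun e' => rk e' ≤ rk e), cls (n' e') = cls (n e') := by
      intro e' he'
      refine h e' ?_ (mem_unusedAt.mp (mem_filter.mp he').1).2
      rw [hs]; simp only [advance, mem_union]; exact Or.inr he'
    have heM : e ∈ (unusedAt s).filter (fun e' => rk e' ≤ rk e) :=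
      mem_filter.mpr ⟨mem_unusedAt.mpr heA.1, le_rfl⟩
    have heA' : e ∈ availAt n' s := mem_availAt.mpr ⟨heA.1, ne_zero_of_cls_eq (hM e heM) heA.2⟩
    have hA' : (availAt n' s).Nonempty := ⟨e, heA'⟩
    have hmin : Function.argminOn rk (↑(availAt n' s) : Set G.edgeFinset) hA' = e := by
      set f := Function.argminOn rk (↑(availAt n' s) : Set G.edgeFinset) hA' with hf
      have hfA : f ∈ availAt n' s := argminOn_mem_availAt (rk := rk) hA'
      have h1 : rk f ≤ rk e := rk_argminOn_le (rk := rk) hA' heA'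
      have hfM : f ∈ (unusedAt s).filter (fun e' => rk e' ≤ rk e) :=
        mem_filter.mpr ⟨mem_unusedAt.mpr (mem_availAt.mp hfA).1, h1⟩
      have hf0 : n f ≠ 0 := by
        have := (mem_availAt.mp hfA).2
        rwa [Ne, eq_zero_iff_of_cls_eq (hM f hfM)] at this
      have h2 : rk e ≤ rk f := rk_argminOn_le (rk := rk) hA (mem_availAt.mpr ⟨(mem_availAt.mp hfA).1, hf0⟩)
      exact hrk (le_antisymm h1 h2)
    rw [hs, xstep_of_nonempty hd hY hA']
    rw [show advance (rk := rk) (n := n') s (Function.argminOn rk (↑(availAt n' s) : Set G.edgeFinset) hA') =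
      advance (rk := rk) (n := n') s e by rw [hmin]]
    exact advance_congr s e heM hM
  · have h0 : ∀ e' ∈ unusedAt s, n' e' = 0 := by
      intro e' he'
      have h1 : e' ∉ availAt n s := by rw [hA]; exact notMem_empty e'
      rw [mem_availAt, not_and, not_not] at h1
      have h2 := h e' (by rw [hs]; simp only [stuck, mem_union]; exact Or.inr he') (mem_unusedAt.mp he').2
      exact (eq_zero_iff_of_cls_eq h2).mpr (h1 (mem_unusedAt.mp he'))
    have hA' : ¬ (availAt n' s).Nonempty := by
      rintro ⟨e', he'⟩
      exact (mem_availAt.mp he').2 (h0 e' (mem_unusedAt.mpr (mem_availAt.mp he').1))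
    rw [hs, xstep_of_empty hd hY hA']

/-- **Locality of the walk** (the identity behind Aizenman 1982, Lemma 9.1 and eq. (9.8)): two
currents with the same classes on the bonds used by the walk of the first have the same walk, state
by state. [cite: AizenmanCMP1982, §9 Lemma 9.1 and eq. (9.8)] -/
theorem exploreAt_congr (hrk : Function.Injective rk) {n' : Current G} {a : V}
    (h : ∀ e ∈ (explore rk n Y a).used, cls (n' e) = cls (n e)) {k : ℕ}
    (hk : k ≤ Fintype.card G.edgeFinset + 1) : exploreAt rk n' Y a k = exploreAt rk n Y a k := by
  induction k with
  | zero => rfl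
  | succ k ih =>
    rw [exploreAt_succ, exploreAt_succ, ih (Nat.le_of_succ_le hk)]
    refine xstep_congr hrk _ fun e he _ => h e ?_
    rw [← exploreAt_succ] at he
    exact used_exploreAt_mono hk he

/-- **Locality of the walk**, final state. [cite: AizenmanCMP1982, §9 Lemma 9.1 and eq. (9.8)] -/
theorem explore_congr (hrk : Function.Injective rk) {n' : Current G} {a : V}
    (h : ∀ e ∈ (explore rk n Y a).used, cls (n' e) = cls (n e)) : explore rk n' Y a = explore rk n Y a :=
  exploreAt_congr hrk h le_rfl

/-! ### Changing the target -/

/-- A step only reads the target through the test `pos ∈ Y`. [folklore] -/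
theorem xstep_target_congr {Y' : Finset V} (s : XState G) (h : s.pos ∈ Y ↔ s.pos ∈ Y') :
    xstep rk n Y s = xstep rk n Y' s := by
  unfold xstep
  simp only [h]

/-- **Two targets that the respective walks do not tell apart give the same walk**: if the walk with
target `Y` is in `Y` whenever it is in `Y'`, and conversely, the two walks coincide. [folklore] -/
theorem exploreAt_target_congr {Y' : Finset V} {a : V}
    (h : ∀ k, (exploreAt rk n Y a k).pos ∈ Y' → (exploreAt rk n Y a k).pos ∈ Y)
    (h' : ∀ k, (exploreAt rk n Y' a k).pos ∈ Y → (exploreAt rk n Y' a k).pos ∈ Y') (k : ℕ) :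
    exploreAt rk n Y a k = exploreAt rk n Y' a k := by
  induction k with
  | zero => rfl
  | succ k ih =>
    rw [exploreAt_succ, exploreAt_succ, ← ih]
    refine xstep_target_congr _ ⟨fun hY => ?_, h k⟩
    have := h' k
    rw [← ih] at this
    exact this hY

/-- Bookkeeping lemma for the exploration. [folklore] -/
theorem explore_target_congr {Y' : Finset V} {a : V}
    (h : ∀ k, (exploreAt rk n Y a k).pos ∈ Y' → (exploreAt rk n Y a k).pos ∈ Y)
    (h' : ∀ k, (exploreAt rk n Y' a k).pos ∈ Y → (exploreAt rk n Y' a k).pos ∈ Y') :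
    explore rk n Y a = explore rk n Y' a :=
  exploreAt_target_congr h h' _

end Locality


/-! ### Summary at the final state -/

section Final

variable {rk n Y}

/-- The recorded pattern of the walk is `cls ∘ n` on the used bonds. [folklore] -/
theorem pat_explore (a : V) {e : G.edgeFinset} (he : e ∈ (explore rk n Y a).used) :
    (explore rk n Y a).pat e = cls (n e) :=
  pat_exploreAt a _ he

/-- Every used bond of the walk contains a visited site. [folklore] -/
theorem exists_mem_vis_of_mem_used_explore (a : V) {e : G.edgeFinset} (he : e ∈ (explore rk n Y a).used) :
    ∃ v ∈ (explore rk n Y a).vis, v ∈ (e : Sym2 V) :=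
  exists_mem_vis_of_mem_used a _ he

/-- Every used bond of the walk with non-zero current has both ends touched. [folklore] -/
theorem mem_tch_of_mem_used_explore (hrk : Function.Injective rk) (a : V) {e : G.edgeFinset}
    (he : e ∈ (explore rk n Y a).used) (hne : n e ≠ 0) {w : V} (hw : w ∈ (e : Sym2 V)) :
    w ∈ (explore rk n Y a).tch :=
  mem_tch_of_mem_used hrk a _ he hne hw

/-- The touched sites of the walk lie in the cluster of the start (visited sites are reached along
bonds with non-zero current, attempted bonds carry a non-zero current). [folklore] -/
theorem tch_explore_subset_cluster (a : V) : (explore rk n Y a).tch ⊆ n.cluster a :=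
  fun _ hv => mem_cluster_of_mem_tch a _ hv

/-- **The sources of the pattern part.** A current `m` vanishing off the used bonds of the walk of
`n` from `a` and having there the same classes as `n` has sources `{a} ∆ {final site}`: its bonds
with odd value are the traversed bonds, a trail from `a` to the final site. [folklore] -/
theorem sources_eq_of_cls_eq (hrk : Function.Injective rk) (a : V) {m : Current G}
    (h0 : ∀ e ∉ (explore rk n Y a).used, m e = 0)
    (hcls : ∀ e ∈ (explore rk n Y a).used, cls (m e) = cls (n e)) :
    m.sources = {a} ∆ {(explore rk n Y a).pos} := by
  set s := explore rk n Y a with hs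
  ext v
  have hpar := even_travAt_exploreAt (n := n) (Y := Y) hrk a (Fintype.card G.edgeFinset + 1) v
  rw [← explore_eq_exploreAt, ← hs] at hpar
  have hterm : ∀ e : G.edgeFinset, (if v ∈ (e : Sym2 V) then m e else 0) % 2 =
      (if e ∈ s.used then (if Odd (n e) ∧ v ∈ (e : Sym2 V) then 1 else 0) else 0) := by
    intro e
    by_cases hu : e ∈ s.used
    · rw [if_pos hu]
      have hodd : Odd (m e) ↔ Odd (n e) := odd_iff_of_cls_eq (hcls e hu)
      by_cases hp : v ∈ (e : Sym2 V)
      · rw [if_pos hp]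
        by_cases ho : Odd (n e)
        · rw [if_pos ⟨ho, hp⟩]; exact Nat.odd_iff.mp (hodd.mpr ho)
        · rw [if_neg (fun h => ho h.1)]
          exact Nat.even_iff.mp (Nat.not_odd_iff_even.mp fun h => ho (hodd.mp h))
      · rw [if_neg hp, if_neg (fun h => hp h.2)]
    · rw [if_neg hu, h0 e hu]; simp
  have hdeg : (m.degree v) % 2 = (travAt n s v) % 2 := by
    unfold Current.degree travAt
    rw [Finset.sum_nat_mod, Finset.sum_congr rfl fun e _ => hterm e, Finset.sum_ite_mem, Finset.univ_inter]
  rw [mem_sources_iff, Finset.mem_symmDiff, mem_singleton, mem_singleton, Nat.odd_iff, hdeg]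
  rw [Nat.even_iff] at hpar
  by_cases ha : v = a
  · by_cases hp : v = s.pos
    · rw [if_pos ha, if_pos hp] at hpar
      constructor
      · intro h; exfalso; omega
      · rintro (⟨-, h⟩ | ⟨-, h⟩)
        · exact absurd hp h
        · exact absurd ha h
    · rw [if_pos ha, if_neg hp] at hpar
      exact ⟨fun _ => Or.inl ⟨ha, hp⟩, fun _ => by omega⟩
  · by_cases hp : v = s.pos
    · rw [if_neg ha, if_pos hp] at hpar
      exact ⟨fun _ => Or.inr ⟨hp, ha⟩, fun _ => by omega⟩
    · rw [if_neg ha, if_neg hp] at hpar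
      constructor
      · intro h; exfalso; omega
      · rintro (⟨h, -⟩ | ⟨h, -⟩)
        · exact absurd h ha
        · exact absurd h hp

end Final

end Current

end Literature.Probability.LatticeModels

end
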